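import Summits.QuantumFields.YangMills.Theorems.BalabanUVNodesN19VarianceOfAnalyticTilt
import Summits.QuantumFields.YangMills.Theorems.BalabanUVNodesN20HellingerEndpointKernel
import Mathlib.Analysis.Convex.SpecificFunctions.Basic
import Mathlib.Analysis.Convex.Jensen

/-!
# BalabanUVNodes ∕ node N19 (NE7) — TAME CONDITIONING OF THE HELLINGER LETTER, and the `W = ∅` V-SIDE FROM ANALYTIC TILTS of the two ONE-RUN class laws:
# idea-3's edition-3 V-side kernel with CRIT-1's rider R2 («tame-condition FIRST, tilt SECOND»), in the tree and importable — FILE 1a of 2 (one class set)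

Cell `pub-ymgap` (HUMAN RULING D-0062 Track A ∕ director-ym R399 (3a) second-wave width seats), WIDTH SEAT `pub-ymgap-dag-n19-w4` (node n19 = NE7),
generation g6, CLAIM-1 ∕ INTENT-1 (bus 2026-08-28T08:31Z; split for the 400-line rule into 1a = THIS FILE, §1–§3 + toy, and 1b =
`…N19TameConditionedHellingerLetterAlongK`, the wild+tame composition at one key and the K-summation).  Route `Summits/QuantumFields/YangMills/Theses/BalabanUVNodes.lean`,
key item K3⁷ `SpineGivenEndpointR13SepCoPH` (stmt-QuantumFields-20544; skeleton of record v5 941dddb108cbaacf, stub 2 `stub_expansion13H`); filed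
`--kind proof --supports … --as helper`.  COUNT-NEUTRAL.  THEOREMS ONLY (0 `def`, 0 `instance`, 0 `notation`, 0 `sorry`).  ADDITIVE — imports this seat's
`…N19VarianceOfAnalyticTilt` (p614272: `variance_le_of_analytic_tilt_sharp` BY NAME) and dag-n20-w5 g3's `…N20HellingerEndpointKernel` (p616874:
`one_sub_affinity_le_wildMass_add_logMoment`, `mixtureMoment_le_of_regime`, `affinity_self` BY NAME; through it dag-n19-w2 g5's `…N19AffinityClassIndexLaws`:
`affinity_le_one`) + Mathlib's finite Jensen (`ConvexOn.map_sum_le`, `convexOn_exp`); modifies nothing, re-declares nothing of theirs.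

WHY.  ym-nodeO idea-3 g12's kernel `Cruxes/SpineGivenEndpointR13SepCoPH/HellingerRoadSketch.lean` EDITION 3 (9a3cb4ec16d8719f, 2026-08-28T08:00Z) closes the
hellinger road's V-side in two theorems — the one-`(K,t)` kernel `one_sub_bc_classLaw_le_wild_add_tilts` (§11) and the K-summation `hellingerRate_of_tilts` (§12) —
and CRIT-1 g5's re-price (`Cruxes/…/CRIT-1-TRIAGE-hellinger-free-energy-road-ed3.md`, evidence #55 on 20544, 08:20Z; cc this seat) LOCATES finding **F-ed3-1**:
both state the analytic-tilt letter on the FULL class laws (wild classes included — the wild set `W` is idle in the hypotheses, and at radius `r₀∕η_K` the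
full-law letter is NOT what (KR)+(V‑b) supply, since on over-aged components the increment is `O(p₀)`, not `O(η_K·size)`), with the certified REPAIR **R2**
(`Cruxes/…/Crit1ProbeIdea3g12.lean`, evidence #56: `one_sub_bc_le_wildMass_add_tame`): CONDITION ON TAME FIRST,
`1 − bc_T(p,q) ≤ max(p(W), q(W)) + (1 − bc_{T∖W}(p∕p(T∖W), q∕q(T∖W)))`, THEN run the tilt kernel with `W := ∅` on the TAME-RESTRICTED weights.  Both live in
`Cruxes/` (farm-checked, NOT importable).  THIS FILE puts the two ingredients of the repaired kernel in `Theorems/`, in the lane's SPELLED-OUT affinity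
`Σ_T √(p·q)` (no `bc` def), each step cited BY NAME:
* §1 ★ `one_sub_affinity_le_wildMass_add_conditioned` — R2 (CRIT-1's certificate re-proved against `Σ√(pq)`; `affinity_le_half_mass`,
  `affinity_restrict_eq_sqrt_mass_mul_conditioned` = the two lines it rests on) + `sqrt_one_sub_affinity_le_of_conditioned` (the same in √-currency).
* §2 `classLaw_conditioned_eq_restricted` (the tame-conditioned law of class weights `A` IS the class law of `A|_{T∖W}`), whence
  ★ `one_sub_affinity_classLaw_le_wildMass_add_restricted` (§1 for the two runs' class laws: wild mass under each run's OWN law + the defect of the RESTRICTED laws).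
* §3 ★★ `one_sub_affinity_classLaw_le_of_analytic_tilts` — the `W = ∅` V-side on ANY finite class set (F-ed3-1 (a): the STRONGER, correctly-lettered form of
  ed.3 §11): tilts `φ_A, φ_B` of the two class laws by `h = log B − log A`, complex-differentiable on `|s| ≤ r` with bounds `B_A, B_B`, regime
  `1 − Σ√(pq) ≤ 1∕16` ⇒ `1 − Σ√(pq) ≤ (B_A + B_B)∕(2r²)` (Padé V-side and MOMENT BOOTSTRAP = dag-n20-w5's lemmas BY NAME; the centring between the two means =
  Jensen at the two ENDPOINT laws, `mean_logRatio_le_log_sub_log` ∕ `log_sub_log_le_mean_logRatio`; ONE-RUN variances = p614272's SHARP `2B∕r²`).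
* §4 toy (A6): identical runs — `φ ≡ 0`, affinity `1`, the bound `0` is attained; the antecedent of §3 is inhabited.
FILE 1b applies §3 to `S := T ∖ W` under §2∕§1 (`1 − Σ_T√(p_A p_B) ≤ max(p_A(W), p_B(W)) + (B_A^{tame} + B_B^{tame})∕(2r²)` — the ed.4 patch CRIT-1 asked for,
as an importable theorem) and sums over keys (`∃ η ≥ 0`, `Σ√η_K < ∞`, `1 − 𝒜_K(t) ≤ η_K` — the (H) letter of the landed class-law∕TV roads).
CREDIT.  R2 and F-ed3-1: CRIT-1 g5 (refuter-ym-nodeO-crit-1-g5-0); the road, its kernel and the `W = ∅` chain: idea-3 g10–g12 (`YMNodeOIdeate.Idea3.HellingerRoad.*`);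
the endpoint lemmas consumed: dag-n20-w5 g3 (p616874), dag-n19-w2 g5 (p612301); the tilt-variance supplier: this seat's g5 (p614272).

HONEST FRAMING.  [folklore] finite-sum real analysis and one-variable complex analysis (Cauchy estimates, consumed by name) on hypothesis SHAPES; every letter
(class weights, wild sets, tilts `φ`, radius `r`, bounds `B`, the regime) is a HYPOTHESIS produced by nobody — the analyticity of a run's TAME tilted class
sum is the content of the card's (KR)+(V‑b) letters ((V‑b) = (YG) two-run, UNPRINTED for d = 4), NOT asserted; NO estimate of Bałaban's programme is proved;
nothing of Bałaban's asserted or instantiated (no `Provisos₁₃CoPH` tuple — K0⁷ OPEN); NE7 ∕ NE7b ∕ NE7c NOT PRINTED as two-run statements for d = 4 and NOT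
proved; N19 ∕ N20 ∕ N21 NOT discharged; K3⁷ OPEN, v5 STANDS, not claimed; no summit statement is proved by this seat; counts UNMOVED (typed 28∕28 · discharged
5∕27, A 5∕28).  One finite four-torus programme at fixed ε — NOT ℝ⁴, NOT infinite volume, NOT OS, NOT a mass gap, NOT the Clay problem (R4 closes the conditional
finite-𝕋⁴ rung `BalabanLadder.UV` only).  0 `def`; 0 `sorry`; standard axioms; no cite tags.
-/

noncomputable section

namespace Summit.QuantumFields.YangMills.BalabanUVNodes.N19TameConditionedHellingerLetter

open Finset
open Summit.QuantumFields.YangMills.BalabanUVNodes.N19AffinityClassIndexLaws (affinity_le_one)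
open Summit.QuantumFields.YangMills.BalabanUVNodes.N20HellingerEndpointKernel
  (mixtureMoment_le_of_regime one_sub_affinity_le_wildMass_add_logMoment affinity_self)
open Summit.QuantumFields.YangMills.BalabanUVNodes.N19VarianceOfAnalyticTilt (variance_le_of_analytic_tilt_sharp)

variable {ι : Type*}

/-! ## §1 Tame conditioning of the affinity defect [folklore; CRIT-1 g5's rider R2] -/

section Conditioning
variable {T : Finset ι} {p q : ι → ℝ}

/-- The affinity `Σ_T √(p·q)` of two nonnegative (sub-probability) vectors is at most HALF THEIR TOTAL MASS [folklore; AM–GM termwise — the tree's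
`Literature.Analysis.FluidPDE.sqrt_mul_le_add_half`, inlined to keep the imports local, as in dag-n19-w2's `affinity_le_one`]. -/
theorem affinity_le_half_mass (T : Finset ι) (hp : ∀ τ ∈ T, 0 ≤ p τ) (hq : ∀ τ ∈ T, 0 ≤ q τ) :
    ∑ τ ∈ T, Real.sqrt (p τ * q τ) ≤ ((∑ τ ∈ T, p τ) + ∑ τ ∈ T, q τ) / 2 := by
  have amgm : ∀ τ ∈ T, Real.sqrt (p τ * q τ) ≤ (p τ + q τ) / 2 := fun τ hτ => by
    have h : p τ * q τ ≤ ((p τ + q τ) / 2) ^ 2 := by nlinarith [sq_nonneg (p τ - q τ)]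
    calc Real.sqrt (p τ * q τ) ≤ Real.sqrt (((p τ + q τ) / 2) ^ 2) := Real.sqrt_le_sqrt h
      _ = (p τ + q τ) / 2 := Real.sqrt_sq (by linarith [hp τ hτ, hq τ hτ])
  calc ∑ τ ∈ T, Real.sqrt (p τ * q τ) ≤ ∑ τ ∈ T, (p τ + q τ) / 2 := sum_le_sum amgm
    _ = ((∑ τ ∈ T, p τ) + ∑ τ ∈ T, q τ) / 2 := by rw [← sum_div, sum_add_distrib]

/-- FACTORISATION OF THE TAME PART [algebra]: on a set `S` where both masses `P = Σ_S p`, `Q = Σ_S q` are positive,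
`Σ_S √(p·q) = √(P·Q) · Σ_S √((p∕P)·(q∕Q))` — the affinity restricted to `S` is the geometric mean of the two masses times the
affinity of the two CONDITIONED laws `p∕P`, `q∕Q` on `S`. -/
theorem affinity_restrict_eq_sqrt_mass_mul_conditioned (S : Finset ι)
    (hP : 0 < ∑ τ ∈ S, p τ) (hQ : 0 < ∑ τ ∈ S, q τ) :
    ∑ τ ∈ S, Real.sqrt (p τ * q τ)
      = Real.sqrt ((∑ τ ∈ S, p τ) * ∑ τ ∈ S, q τ)
        * ∑ τ ∈ S, Real.sqrt ((p τ / ∑ σ ∈ S, p σ) * (q τ / ∑ σ ∈ S, q σ)) := by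
  set P := ∑ σ ∈ S, p σ with hPdef
  set Q := ∑ σ ∈ S, q σ with hQdef
  have hPQ : 0 < P * Q := mul_pos hP hQ
  rw [mul_sum]
  refine sum_congr rfl fun τ _ => ?_
  rw [div_mul_div_comm, Real.sqrt_div' _ hPQ.le, mul_div_cancel₀ _ (Real.sqrt_pos.2 hPQ).ne']

/-- **★ TAME CONDITIONING OF THE AFFINITY DEFECT** [folklore; CRIT-1 g5's rider R2, certified in the crux workfile
`Cruxes/SpineGivenEndpointR13SepCoPH/Crit1ProbeIdea3g12.lean` (`one_sub_bc_le_wildMass_add_tame`) and re-proved here against the SPELLED-OUT affinity].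
For two laws `p, q` on `T` (nonnegative, total mass one) and a «wild» set `W ⊆ T` off which both laws keep positive mass,
`1 − Σ_T √(p·q) ≤ max(p(W), q(W)) + (1 − Σ_{T∖W} √((p∕p(T∖W))·(q∕q(T∖W))))`:
the Hellinger letter splits into the LARGER WILD MASS plus the affinity defect of the two TAME-CONDITIONED laws — and only the latter
will be asked to carry analytic tilts (§3–§4).  Proof: `Σ_T √(pq) ≥ Σ_{T∖W} √(pq) = √(PQ)·𝒜_tame`, `√(PQ) ≥ 1 − max(p(W), q(W))`, `𝒜_tame ≤ 1`. -/
theorem one_sub_affinity_le_wildMass_add_conditioned [DecidableEq ι] {W : Finset ι} (hW : W ⊆ T)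
    (hp : ∀ τ ∈ T, 0 ≤ p τ) (hq : ∀ τ ∈ T, 0 ≤ q τ)
    (hp1 : ∑ τ ∈ T, p τ = 1) (hq1 : ∑ τ ∈ T, q τ = 1)
    (hP : 0 < ∑ τ ∈ T \ W, p τ) (hQ : 0 < ∑ τ ∈ T \ W, q τ) :
    1 - ∑ τ ∈ T, Real.sqrt (p τ * q τ)
      ≤ max (∑ τ ∈ W, p τ) (∑ τ ∈ W, q τ)
        + (1 - ∑ τ ∈ T \ W, Real.sqrt ((p τ / ∑ σ ∈ T \ W, p σ) * (q τ / ∑ σ ∈ T \ W, q σ))) := by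
  -- adapted from `Cruxes/SpineGivenEndpointR13SepCoPH/Crit1ProbeIdea3g12.lean` (CRIT-1 g5), `bc` spelled out
  set P := ∑ τ ∈ T \ W, p τ with hPdef
  set Q := ∑ τ ∈ T \ W, q τ with hQdef
  set m := max (∑ τ ∈ W, p τ) (∑ τ ∈ W, q τ) with hmdef
  set b' := ∑ τ ∈ T \ W, Real.sqrt ((p τ / P) * (q τ / Q)) with hb'def
  have hPW : P + ∑ τ ∈ W, p τ = 1 := by rw [hPdef, sum_sdiff hW]; exact hp1
  have hQW : Q + ∑ τ ∈ W, q τ = 1 := by rw [hQdef, sum_sdiff hW]; exact hq1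
  have hP1m : 1 - m ≤ P := by have := le_max_left (∑ τ ∈ W, p τ) (∑ τ ∈ W, q τ); linarith
  have hQ1m : 1 - m ≤ Q := by have := le_max_right (∑ τ ∈ W, p τ) (∑ τ ∈ W, q τ); linarith
  have hm0 : 0 ≤ m := le_trans (sum_nonneg fun τ hτ => hp τ (hW hτ)) (le_max_left _ _)
  have hsdp : ∀ τ ∈ T \ W, 0 ≤ p τ := fun τ hτ => hp τ (sdiff_subset hτ)
  have hsdq : ∀ τ ∈ T \ W, 0 ≤ q τ := fun τ hτ => hq τ (sdiff_subset hτ)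
  have hS : ∑ τ ∈ T \ W, Real.sqrt (p τ * q τ) = Real.sqrt (P * Q) * b' :=
    affinity_restrict_eq_sqrt_mass_mul_conditioned (T \ W) hP hQ
  have hsplit : ∑ τ ∈ T, Real.sqrt (p τ * q τ)
      = ∑ τ ∈ T \ W, Real.sqrt (p τ * q τ) + ∑ τ ∈ W, Real.sqrt (p τ * q τ) := (sum_sdiff hW).symm
  have hWnn : 0 ≤ ∑ τ ∈ W, Real.sqrt (p τ * q τ) := sum_nonneg fun _ _ => Real.sqrt_nonneg _
  have hb'0 : 0 ≤ b' := sum_nonneg fun _ _ => Real.sqrt_nonneg _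
  have hb'1 : b' ≤ 1 := by
    have h := affinity_le_half_mass (T \ W) (p := fun τ => p τ / P) (q := fun τ => q τ / Q)
      (fun τ hτ => div_nonneg (hsdp τ hτ) hP.le) (fun τ hτ => div_nonneg (hsdq τ hτ) hQ.le)
    have e1 : ∑ τ ∈ T \ W, p τ / P = 1 := by rw [← sum_div, div_self hP.ne']
    have e2 : ∑ τ ∈ T \ W, q τ / Q = 1 := by rw [← sum_div, div_self hQ.ne']
    rw [e1, e2] at h; rw [hb'def]; linarith
  rcases le_or_gt m 1 with hm1 | hm1
  · have hsq : 1 - m ≤ Real.sqrt (P * Q) := by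
      have hmul : (1 - m) * (1 - m) ≤ P * Q := mul_le_mul hP1m hQ1m (by linarith) hP.le
      calc 1 - m = Real.sqrt ((1 - m) ^ 2) := (Real.sqrt_sq (by linarith)).symm
        _ ≤ Real.sqrt (P * Q) := Real.sqrt_le_sqrt (by nlinarith [hmul])
    have h1 : b' * (1 - m) ≤ ∑ τ ∈ T, Real.sqrt (p τ * q τ) := by
      rw [hsplit, hS]; have := mul_le_mul_of_nonneg_left hsq hb'0; linarith
    nlinarith [h1, hb'1, hm0]
  · have : 0 ≤ ∑ τ ∈ T, Real.sqrt (p τ * q τ) := sum_nonneg fun _ _ => Real.sqrt_nonneg _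
    linarith

/-- **The same in HELLINGER (square-root) currency**, the shape summed over keys in §5 [folklore]:
`√(1 − Σ_T √(pq)) ≤ √(max(p(W), q(W))) + √(1 − 𝒜_tame)`. -/
theorem sqrt_one_sub_affinity_le_of_conditioned [DecidableEq ι] {W : Finset ι} (hW : W ⊆ T)
    (hp : ∀ τ ∈ T, 0 ≤ p τ) (hq : ∀ τ ∈ T, 0 ≤ q τ)
    (hp1 : ∑ τ ∈ T, p τ = 1) (hq1 : ∑ τ ∈ T, q τ = 1)
    (hP : 0 < ∑ τ ∈ T \ W, p τ) (hQ : 0 < ∑ τ ∈ T \ W, q τ) :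
    Real.sqrt (1 - ∑ τ ∈ T, Real.sqrt (p τ * q τ))
      ≤ Real.sqrt (max (∑ τ ∈ W, p τ) (∑ τ ∈ W, q τ))
        + Real.sqrt (1 - ∑ τ ∈ T \ W, Real.sqrt ((p τ / ∑ σ ∈ T \ W, p σ) * (q τ / ∑ σ ∈ T \ W, q σ))) := by
  have h := one_sub_affinity_le_wildMass_add_conditioned hW hp hq hp1 hq1 hP hQ
  have hm0 : 0 ≤ max (∑ τ ∈ W, p τ) (∑ τ ∈ W, q τ) :=
    le_trans (sum_nonneg fun τ hτ => hp τ (hW hτ)) (le_max_left _ _)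
  have hsd : ∀ τ ∈ T \ W, 0 ≤ p τ := fun τ hτ => hp τ (sdiff_subset hτ)
  have hsd' : ∀ τ ∈ T \ W, 0 ≤ q τ := fun τ hτ => hq τ (sdiff_subset hτ)
  have htame : 0 ≤ 1 - ∑ τ ∈ T \ W, Real.sqrt ((p τ / ∑ σ ∈ T \ W, p σ) * (q τ / ∑ σ ∈ T \ W, q σ)) := by
    have h1 := affinity_le_one (T \ W) (p := fun τ => p τ / ∑ σ ∈ T \ W, p σ) (q := fun τ => q τ / ∑ σ ∈ T \ W, q σ)
      (fun τ hτ => div_nonneg (hsd τ hτ) hP.le) (fun τ hτ => div_nonneg (hsd' τ hτ) hQ.le)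
      (by rw [← sum_div, div_self hP.ne']) (by rw [← sum_div, div_self hQ.ne'])
    linarith
  -- `√(a + b) ≤ √a + √b` (the tree's `Literature.NumberTheory.LFunctions.MRT2015.sqrt_add_le_sqrt_add_sqrt`, inlined to keep the imports local)
  have hsub : ∀ {a b : ℝ}, 0 ≤ a → 0 ≤ b → Real.sqrt (a + b) ≤ Real.sqrt a + Real.sqrt b := fun {a b} ha hb => by
    rw [Real.sqrt_le_left (by positivity)]
    nlinarith [Real.sq_sqrt ha, Real.sq_sqrt hb, mul_nonneg (Real.sqrt_nonneg a) (Real.sqrt_nonneg b)]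
  exact (Real.sqrt_le_sqrt h).trans (hsub hm0 htame)

end Conditioning

/-! ## §2 The tame-conditioned law of CLASS WEIGHTS is the class law of the RESTRICTED weights [algebra] -/

section ClassLaws
variable {T : Finset ι} {A B : ι → ℝ}

/-- For class weights `A` with class law `p = A∕Z_A`, `Z_A = Σ_T A ≠ 0`: conditioning `p` on a set `S` gives the class law of the weights
RESTRICTED to `S`, `(A_τ∕Z_A)∕p(S) = A_τ∕Σ_S A` [algebra].  (So every «class laws of positive weights on a finite set» lemma of the lane applies
to the tame part VERBATIM, with `T` replaced by `T ∖ W`.) -/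
theorem classLaw_conditioned_eq_restricted (S : Finset ι) (hZ : (∑ σ ∈ T, A σ) ≠ 0) (τ : ι) :
    (A τ / ∑ σ ∈ T, A σ) / (∑ σ ∈ S, A σ / ∑ σ' ∈ T, A σ') = A τ / ∑ σ ∈ S, A σ := by
  rw [← sum_div, div_div_div_cancel_right₀ hZ]

/-- The class-law mass of a set is the restricted total over the full total: `p(W) = Σ_W A ∕ Σ_T A` [algebra]. -/
theorem classLaw_mass_eq (W : Finset ι) : ∑ τ ∈ W, A τ / ∑ σ ∈ T, A σ = (∑ τ ∈ W, A τ) / ∑ σ ∈ T, A σ := by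
  rw [← sum_div]

/-- The affinity of the two tame-conditioned CLASS laws is the affinity of the class laws of the RESTRICTED weights [algebra]. -/
theorem affinity_conditioned_classLaw_eq_restricted (S : Finset ι)
    (hZA : (∑ σ ∈ T, A σ) ≠ 0) (hZB : (∑ σ ∈ T, B σ) ≠ 0) :
    ∑ τ ∈ S, Real.sqrt (((A τ / ∑ σ ∈ T, A σ) / ∑ σ ∈ S, A σ / ∑ σ' ∈ T, A σ')
        * ((B τ / ∑ σ ∈ T, B σ) / ∑ σ ∈ S, B σ / ∑ σ' ∈ T, B σ'))
      = ∑ τ ∈ S, Real.sqrt ((A τ / ∑ σ ∈ S, A σ) * (B τ / ∑ σ ∈ S, B σ)) := by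
  refine sum_congr rfl fun τ _ => ?_
  rw [classLaw_conditioned_eq_restricted S hZA, classLaw_conditioned_eq_restricted S hZB]

/-- **★ §1 FOR CLASS WEIGHTS** [folklore]: for positive class weights `A, B` of the two runs on `T` and a wild set `W ⊆ T` with `T ∖ W` nonempty,
`1 − Σ_T √(p_A p_B) ≤ max(Σ_W A∕Σ_T A, Σ_W B∕Σ_T B) + (1 − Σ_{T∖W} √((A∕Σ_{T∖W}A)·(B∕Σ_{T∖W}B)))` — wild mass under each run's OWN class law,
plus the affinity defect of the class laws of the TAME-RESTRICTED weights. -/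
theorem one_sub_affinity_classLaw_le_wildMass_add_restricted [DecidableEq ι] {W : Finset ι} (hW : W ⊆ T)
    (hA : ∀ τ ∈ T, 0 < A τ) (hB : ∀ τ ∈ T, 0 < B τ) (hne : (T \ W).Nonempty) :
    1 - ∑ τ ∈ T, Real.sqrt ((A τ / ∑ σ ∈ T, A σ) * (B τ / ∑ σ ∈ T, B σ))
      ≤ max ((∑ τ ∈ W, A τ) / ∑ σ ∈ T, A σ) ((∑ τ ∈ W, B τ) / ∑ σ ∈ T, B σ)
        + (1 - ∑ τ ∈ T \ W, Real.sqrt ((A τ / ∑ σ ∈ T \ W, A σ) * (B τ / ∑ σ ∈ T \ W, B σ))) := by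
  have hT : T.Nonempty := hne.mono sdiff_subset
  have hZA : 0 < ∑ σ ∈ T, A σ := sum_pos hA hT
  have hZB : 0 < ∑ σ ∈ T, B σ := sum_pos hB hT
  have hSA : 0 < ∑ σ ∈ T \ W, A σ := sum_pos (fun τ hτ => hA τ (sdiff_subset hτ)) hne
  have hSB : 0 < ∑ σ ∈ T \ W, B σ := sum_pos (fun τ hτ => hB τ (sdiff_subset hτ)) hne
  have hp : ∀ τ ∈ T, 0 ≤ A τ / ∑ σ ∈ T, A σ := fun τ hτ => div_nonneg (hA τ hτ).le hZA.le
  have hq : ∀ τ ∈ T, 0 ≤ B τ / ∑ σ ∈ T, B σ := fun τ hτ => div_nonneg (hB τ hτ).le hZB.le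
  have hp1 : ∑ τ ∈ T, A τ / ∑ σ ∈ T, A σ = 1 := by rw [← sum_div, div_self hZA.ne']
  have hq1 : ∑ τ ∈ T, B τ / ∑ σ ∈ T, B σ = 1 := by rw [← sum_div, div_self hZB.ne']
  have hP : 0 < ∑ τ ∈ T \ W, A τ / ∑ σ ∈ T, A σ := by rw [← sum_div]; exact div_pos hSA hZA
  have hQ : 0 < ∑ τ ∈ T \ W, B τ / ∑ σ ∈ T, B σ := by rw [← sum_div]; exact div_pos hSB hZB
  have h := one_sub_affinity_le_wildMass_add_conditioned (p := fun τ => A τ / ∑ σ ∈ T, A σ)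
    (q := fun τ => B τ / ∑ σ ∈ T, B σ) hW hp hq hp1 hq1 hP hQ
  rw [affinity_conditioned_classLaw_eq_restricted (T \ W) hZA.ne' hZB.ne',
    classLaw_mass_eq (T := T) (A := A) W, classLaw_mass_eq (T := T) (A := B) W] at h
  exact h

end ClassLaws

/-! ## §3 The `W = ∅` V-side from ANALYTIC TILTS of the two one-run class laws (F-ed3-1 (a): the stronger statement) [folklore] -/

section Tilts
variable {S : Finset ι} {A B : ι → ℝ}

/-- Jensen [folklore; the lower Gibbs–Bogoliubov bound]: for positive weights `A, B` on a nonempty `S`,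
`⟨log B − log A⟩_A ≤ log Σ_S B − log Σ_S A` (convexity of `exp` under the law `A∕Σ A`; Mathlib `ConvexOn.map_sum_le`). -/
theorem mean_logRatio_le_log_sub_log (hS : S.Nonempty) (hA : ∀ τ ∈ S, 0 < A τ) (hB : ∀ τ ∈ S, 0 < B τ) :
    (∑ τ ∈ S, A τ * (Real.log (B τ) - Real.log (A τ))) / (∑ τ ∈ S, A τ)
      ≤ Real.log (∑ τ ∈ S, B τ) - Real.log (∑ τ ∈ S, A τ) := by
  set ZA := ∑ τ ∈ S, A τ with hZAdef
  set ZB := ∑ τ ∈ S, B τ with hZBdef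
  have hZA : 0 < ZA := sum_pos hA hS
  have hZB : 0 < ZB := sum_pos hB hS
  have hJ := (convexOn_exp).map_sum_le (t := S) (w := fun τ => A τ / ZA)
    (p := fun τ => Real.log (B τ) - Real.log (A τ))
    (fun τ hτ => div_nonneg (hA τ hτ).le hZA.le) (by rw [← sum_div, div_self hZA.ne']) (fun _ _ => Set.mem_univ _)
  simp only [smul_eq_mul] at hJ
  have e1 : ∑ τ ∈ S, A τ / ZA * Real.exp (Real.log (B τ) - Real.log (A τ)) = ZB / ZA := by
    rw [hZBdef, sum_div]
    refine sum_congr rfl fun τ hτ => ?_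
    rw [Real.exp_sub, Real.exp_log (hB τ hτ), Real.exp_log (hA τ hτ)]
    field_simp [(hA τ hτ).ne']
  have e2 : ∑ τ ∈ S, A τ / ZA * (Real.log (B τ) - Real.log (A τ))
      = (∑ τ ∈ S, A τ * (Real.log (B τ) - Real.log (A τ))) / ZA := by
    rw [sum_div]; exact sum_congr rfl fun _ _ => by ring
  rw [e1, e2] at hJ
  rw [← Real.log_div hZB.ne' hZA.ne', Real.le_log_iff_exp_le (div_pos hZB hZA)]
  exact hJ

/-- Jensen, the other endpoint [folklore; the upper Gibbs–Bogoliubov bound]: `log Σ_S B − log Σ_S A ≤ ⟨log B − log A⟩_B`. -/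
theorem log_sub_log_le_mean_logRatio (hS : S.Nonempty) (hA : ∀ τ ∈ S, 0 < A τ) (hB : ∀ τ ∈ S, 0 < B τ) :
    Real.log (∑ τ ∈ S, B τ) - Real.log (∑ τ ∈ S, A τ)
      ≤ (∑ τ ∈ S, B τ * (Real.log (B τ) - Real.log (A τ))) / (∑ τ ∈ S, B τ) := by
  have h := mean_logRatio_le_log_sub_log hS hB hA
  have e : ∑ τ ∈ S, B τ * (Real.log (A τ) - Real.log (B τ)) = -∑ τ ∈ S, B τ * (Real.log (B τ) - Real.log (A τ)) := by
    rw [← sum_neg_distrib]; exact sum_congr rfl fun _ _ => by ring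
  rw [e, neg_div] at h
  linarith

/-- Bookkeeping [algebra]: the variance of `f` under the class LAW `A∕Z_A` in «law» letters equals the «weights» form of
`…N19VarianceOfAnalyticTilt` (`Σ A (f − Σ A f∕Z_A)² ∕ Z_A`). -/
theorem lawVariance_eq_weightVariance (hZ : (∑ σ ∈ S, A σ) ≠ 0) (f : ι → ℝ) :
    ∑ τ ∈ S, A τ / (∑ σ ∈ S, A σ) * (f τ - ∑ σ ∈ S, A σ / (∑ σ' ∈ S, A σ') * f σ) ^ 2
      = (∑ τ ∈ S, A τ * (f τ - (∑ σ ∈ S, A σ * f σ) / ∑ σ ∈ S, A σ) ^ 2) / ∑ σ ∈ S, A σ := by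
  have e1 : ∑ σ ∈ S, A σ / (∑ σ' ∈ S, A σ') * f σ = (∑ σ ∈ S, A σ * f σ) / ∑ σ ∈ S, A σ := by
    rw [sum_div]; exact sum_congr rfl fun _ _ => by ring
  rw [e1, eq_div_iff hZ, Finset.sum_mul]
  exact sum_congr rfl fun _ _ => by field_simp

/-- **★★ THE `W = ∅` V-SIDE FROM ANALYTIC TILTS** [folklore; idea-3 ed.3 §11 `one_sub_bc_classLaw_le_wild_add_tilts` at `W := ∅` — by CRIT-1's
F-ed3-1 (a) the STRONGER and correctly-lettered statement —, with the SHARP Cauchy constant].  On ANY finite class set `S`: positive weights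
`A, B` (the two runs' keyed class weights, or their TAME restrictions), the two class laws `p = A∕Σ_S A`, `q = B∕Σ_S B`, the two-run increment
`h = log B − log A`; if for each run ONE BRANCH `φ` of the logarithm of that run's `h`-TILTED, normalised class sum
(`e^{φ_A(s)} = Σ_S A e^{s h} ∕ Σ_S A`, `e^{φ_B(s)} = Σ_S B e^{s h} ∕ Σ_S B`) is complex-differentiable on the closed disc `|s| ≤ r` with
`|φ_A| ≤ B_A`, `|φ_B| ≤ B_B` there, and the pair is in the perturbative regime `1 − Σ_S √(pq) ≤ 1∕16`, then
`1 − Σ_S √(p·q) ≤ (B_A + B_B) ∕ (2r²)`.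
Chain, all BY NAME: Padé V-side `1 − 𝒜 ≤ ⅛ Σ(p+q)(log p − log q)²` (dag-n20-w5 `one_sub_affinity_le_wildMass_add_logMoment`, `W := ∅`) with
`log p − log q = −(h − c)`, `c = log Σ B − log Σ A`; the centring lies between the two means (Jensen, above); MOMENT BOOTSTRAP in the regime
(dag-n20-w5 `mixtureMoment_le_of_regime`): `Σ ½(p+q)(h − c)² ≤ Var_p h + Var_q h`; each ONE-RUN variance `≤ 2B∕r²` (this seat's p614272
`variance_le_of_analytic_tilt_sharp`).  No interpolated ensemble; no wild set; no bad-class dial; no range constant. -/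
theorem one_sub_affinity_classLaw_le_of_analytic_tilts (hA : ∀ τ ∈ S, 0 < A τ) (hB : ∀ τ ∈ S, 0 < B τ)
    {r BA BB : ℝ} (hr : 0 < r) (φA φB : ℂ → ℂ)
    (hφA : DifferentiableOn ℂ φA (Metric.closedBall 0 r)) (hφB : DifferentiableOn ℂ φB (Metric.closedBall 0 r))
    (hexpA : ∀ s ∈ Metric.closedBall (0:ℂ) r, Complex.exp (φA s)
      = (∑ τ ∈ S, (A τ : ℂ) * Complex.exp (s * ((Real.log (B τ) - Real.log (A τ) : ℝ) : ℂ))) / ∑ τ ∈ S, (A τ : ℂ))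
    (hexpB : ∀ s ∈ Metric.closedBall (0:ℂ) r, Complex.exp (φB s)
      = (∑ τ ∈ S, (B τ : ℂ) * Complex.exp (s * ((Real.log (B τ) - Real.log (A τ) : ℝ) : ℂ))) / ∑ τ ∈ S, (B τ : ℂ))
    (hbA : ∀ s ∈ Metric.closedBall (0:ℂ) r, ‖φA s‖ ≤ BA) (hbB : ∀ s ∈ Metric.closedBall (0:ℂ) r, ‖φB s‖ ≤ BB)
    (hreg : 1 - ∑ τ ∈ S, Real.sqrt ((A τ / ∑ σ ∈ S, A σ) * (B τ / ∑ σ ∈ S, B σ)) ≤ 1 / 16) :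
    1 - ∑ τ ∈ S, Real.sqrt ((A τ / ∑ σ ∈ S, A σ) * (B τ / ∑ σ ∈ S, B σ)) ≤ (BA + BB) / (2 * r ^ 2) := by
  classical
  rcases S.eq_empty_or_nonempty with hS0 | hS
  · exfalso; subst hS0; simp at hreg; norm_num at hreg
  set ZA := ∑ σ ∈ S, A σ with hZAdef
  set ZB := ∑ σ ∈ S, B σ with hZBdef
  have hZA : 0 < ZA := sum_pos hA hS
  have hZB : 0 < ZB := sum_pos hB hS
  -- the two one-run class laws
  set p : ι → ℝ := fun τ => A τ / ZA with hpdef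
  set q : ι → ℝ := fun τ => B τ / ZB with hqdef
  have hp : ∀ τ ∈ S, 0 ≤ p τ := fun τ hτ => div_nonneg (hA τ hτ).le hZA.le
  have hq : ∀ τ ∈ S, 0 ≤ q τ := fun τ hτ => div_nonneg (hB τ hτ).le hZB.le
  have hp' : ∀ τ ∈ S \ ∅, 0 < p τ := fun τ hτ => div_pos (hA τ (sdiff_subset hτ)) hZA
  have hq' : ∀ τ ∈ S \ ∅, 0 < q τ := fun τ hτ => div_pos (hB τ (sdiff_subset hτ)) hZB
  have hp1 : ∑ τ ∈ S, p τ = 1 := by simp only [hpdef]; rw [← sum_div, div_self hZA.ne']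
  have hq1 : ∑ τ ∈ S, q τ = 1 := by simp only [hqdef]; rw [← sum_div, div_self hZB.ne']
  have haff : ∑ τ ∈ S, Real.sqrt ((A τ / ∑ σ ∈ S, A σ) * (B τ / ∑ σ ∈ S, B σ)) = ∑ τ ∈ S, Real.sqrt (p τ * q τ) := rfl
  rw [haff] at hreg ⊢
  -- increment and centring
  set h : ι → ℝ := fun τ => Real.log (B τ) - Real.log (A τ) with hhdef
  set c : ℝ := Real.log ZB - Real.log ZA with hcdef
  -- (1) Padé V-side with `W := ∅` (dag-n20-w5, by name), rewritten with `log p − log q = −(h − c)`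
  have hV := one_sub_affinity_le_wildMass_add_logMoment hp hq hp1 hq1 (W := ∅) (empty_subset S) hp' hq'
  rw [sum_empty, zero_div, zero_add, sdiff_empty] at hV
  have elog : ∀ τ ∈ S, (Real.log (p τ) - Real.log (q τ)) ^ 2 = (h τ - c) ^ 2 := by
    intro τ hτ
    simp only [hpdef, hqdef, hhdef, hcdef]
    rw [Real.log_div (hA τ hτ).ne' hZA.ne', Real.log_div (hB τ hτ).ne' hZB.ne']
    ring
  have hV' : 1 - ∑ τ ∈ S, Real.sqrt (p τ * q τ) ≤ (∑ τ ∈ S, (p τ + q τ) / 2 * (h τ - c) ^ 2) / 4 := by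
    have e : ∑ τ ∈ S, (p τ + q τ) * (Real.log (p τ) - Real.log (q τ)) ^ 2
        = ∑ τ ∈ S, (p τ + q τ) * (h τ - c) ^ 2 := sum_congr rfl fun τ hτ => by rw [elog τ hτ]
    have e' : (∑ τ ∈ S, (p τ + q τ) / 2 * (h τ - c) ^ 2) / 4 = (∑ τ ∈ S, (p τ + q τ) * (h τ - c) ^ 2) / 8 := by
      rw [div_eq_div_iff (by norm_num : (4:ℝ) ≠ 0) (by norm_num : (8:ℝ) ≠ 0), sum_mul, sum_mul]
      exact sum_congr rfl fun _ _ => by ring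
    rw [e'] ; rw [e] at hV; exact hV
  -- (2) the centring lies between the two means (Jensen at the two endpoint laws)
  have hlo : ∑ τ ∈ S, p τ * h τ ≤ c := by
    have h1 := mean_logRatio_le_log_sub_log hS hA hB
    have e : ∑ τ ∈ S, p τ * h τ = (∑ τ ∈ S, A τ * (Real.log (B τ) - Real.log (A τ))) / ZA := by
      simp only [hpdef, hhdef]; rw [sum_div]; exact sum_congr rfl fun _ _ => by ring
    rw [e]; exact h1
  have hhi : c ≤ ∑ τ ∈ S, q τ * h τ := by
    have h1 := log_sub_log_le_mean_logRatio hS hA hB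
    have e : ∑ τ ∈ S, q τ * h τ = (∑ τ ∈ S, B τ * (Real.log (B τ) - Real.log (A τ))) / ZB := by
      simp only [hqdef, hhdef]; rw [sum_div]; exact sum_congr rfl fun _ _ => by ring
    rw [e]; exact h1
  -- (3) moment bootstrap in the regime (dag-n20-w5, by name)
  have hM := mixtureMoment_le_of_regime hp hq hp1 hq1 h hlo hhi hreg
  -- (4) the two one-run variances from the analytic tilts (this seat's p614272, by name)
  have hVA := variance_le_of_analytic_tilt_sharp S A h hA hr φA hφA hexpA hbA
  have hVB := variance_le_of_analytic_tilt_sharp S B h hB hr φB hφB hexpB hbB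
  have eA : ∑ τ ∈ S, p τ * (h τ - ∑ σ ∈ S, p σ * h σ) ^ 2
      = (∑ τ ∈ S, A τ * (h τ - (∑ σ ∈ S, A σ * h σ) / ∑ σ ∈ S, A σ) ^ 2) / ∑ σ ∈ S, A σ := by
    simp only [hpdef, hZAdef]; exact lawVariance_eq_weightVariance hZA.ne' h
  have eB : ∑ τ ∈ S, q τ * (h τ - ∑ σ ∈ S, q σ * h σ) ^ 2
      = (∑ τ ∈ S, B τ * (h τ - (∑ σ ∈ S, B σ * h σ) / ∑ σ ∈ S, B σ) ^ 2) / ∑ σ ∈ S, B σ := by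
    simp only [hqdef, hZBdef]; exact lawVariance_eq_weightVariance hZB.ne' h
  rw [eA, eB] at hM
  have hr2 : 0 < r ^ 2 := by positivity
  calc 1 - ∑ τ ∈ S, Real.sqrt (p τ * q τ)
      ≤ (∑ τ ∈ S, (p τ + q τ) / 2 * (h τ - c) ^ 2) / 4 := hV'
    _ ≤ (2 * BA / r ^ 2 + 2 * BB / r ^ 2) / 4 := by
        exact div_le_div_of_nonneg_right (hM.trans (add_le_add hVA hVB)) (by norm_num)
    _ = (BA + BB) / (2 * r ^ 2) := by field_simp; ring

end Tilts

/-! ## §4 Toy (A6): the hypothesis set of §3 is inhabited — identical runs [folklore] -/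

section Toy
variable {S : Finset ι} {A : ι → ℝ}

/-- Identical weights: the `h`-tilt is trivial (`h = 0`), the branch `φ ≡ 0` works with bound `0`, the regime holds with room to spare (affinity `1`),
and §3 returns `1 − 𝒜 ≤ 0` — attained.  Source-free; shows the antecedent of `one_sub_affinity_classLaw_le_of_analytic_tilts` is not vacuous. -/
theorem toy_identical_runs (hS : S.Nonempty) (hA : ∀ τ ∈ S, 0 < A τ) {r : ℝ} (hr : 0 < r) :
    1 - ∑ τ ∈ S, Real.sqrt ((A τ / ∑ σ ∈ S, A σ) * (A τ / ∑ σ ∈ S, A σ)) ≤ (0 + 0) / (2 * r ^ 2) := by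
  have hZA : 0 < ∑ σ ∈ S, A σ := sum_pos hA hS
  have hZC : (∑ τ ∈ S, (A τ : ℂ)) ≠ 0 := by
    rw [← Complex.ofReal_sum]; exact_mod_cast hZA.ne'
  have hexp : ∀ s ∈ Metric.closedBall (0:ℂ) r, Complex.exp ((fun _ => (0:ℂ)) s)
      = (∑ τ ∈ S, (A τ : ℂ) * Complex.exp (s * ((Real.log (A τ) - Real.log (A τ) : ℝ) : ℂ))) / ∑ τ ∈ S, (A τ : ℂ) := by
    intro s _
    simp only [sub_self, Complex.ofReal_zero, mul_zero, Complex.exp_zero, mul_one, div_self hZC]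
  have haff : ∑ τ ∈ S, Real.sqrt ((A τ / ∑ σ ∈ S, A σ) * (A τ / ∑ σ ∈ S, A σ)) = 1 :=
    affinity_self (fun τ hτ => div_nonneg (hA τ hτ).le hZA.le) (by rw [← sum_div, div_self hZA.ne'])
  exact one_sub_affinity_classLaw_le_of_analytic_tilts hA hA hr (fun _ => 0) (fun _ => 0)
    (differentiableOn_const _) (differentiableOn_const _) hexp hexp
    (fun _ _ => by simp) (fun _ _ => by simp) (by rw [haff]; norm_num)

end Toy

end Summit.QuantumFields.YangMills.BalabanUVNodes.N19TameConditionedHellingerLetter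

end
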